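import Mathlib
import Summits.ValiantsHypothesis.ValiantsHypothesis.Theorems.GrenetZeonHessianRankCodimTwoLatinGoodPlaneThreePrime
import HarnessLib

/-!
# Crux `GrenetZeon.HessianRankCodimTwo` (stmt-ValiantsHypothesis-8061), line `good_plane`:
# Theorem P down to `p = 11` — the rank count of the Latin plane with the inequality as hypothesis

Seat val-width-8061-p3 g2 (director-valiant 2026-08-27T23:53:55Z extra (c)).  The reduction
`goodPlane_of_latinBlockNonvanishing` (`…LatinPlane`, val-width-8061-p2) asks `12 ≤ m` because it proves the
rank inequality `(3m + r)² < 12 (m-1)²` uniformly for `r ≤ 2`; for `r = 0` the inequality already holds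
from `m = 8` on (`9m² < 12(m-1)²` iff `m² - 8m + 4 > 0`).  Here:

* `goodPlane_of_latinBlockNonvanishing'` — the same reduction with the inequality
  `(3m + r)² < 12 (m-1)²` as a HYPOTHESIS (any `m ≥ 2`, any `r`): (★) `LatinBlockNonvanishing m r`
  ⇒ `GoodPlane (3m + r)` (unfolded); proof verbatim from `…LatinPlane` (block-eigenvector engine, six
  surviving blocks of `(m-1)²` each);
* `goodPlane_three_mul_prime'` — **Theorem P for every prime `p ≥ 11`**: `GoodPlane (3p)`
  (`latinBlockNonvanishing_three_mul_prime` holds for all primes `p ≥ 3`; the engine's count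
  `6 (p-1)² > (3p)²/2` is what needs `p ≥ 8`; `p = 7` misses it by `216 < 220.5`);
* `hessianRankCodimTwo_at_three_mul_prime'` — the crux body at every `n = 3p`, `p ≥ 11` prime.

So `n = 33` joins the list of Theorem P.  VP ≠ VNP is not moved by anything here (the crux feeds only the
constant-factor bound `TwoDimCoefficients`).
-/

noncomputable section

open Matrix Finset MvPolynomial
open Literature.Computability.AlgebraicComplexity

-- single-conjunct layout `Summits/ValiantsHypothesis/ValiantsHypothesis`: duplicated namespace by design
set_option linter.dupNamespace false

namespace Summit.ValiantsHypothesis.ValiantsHypothesis.Theorems.GrenetZeonHessianRankCodimTwo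

section Main

variable {m r : ℕ}

/-- **The Latin block plane is good, given (★) and the rank inequality.** For `m ≥ 2`, any `r`, with
`(3m + r)² < 12 (m-1)²`: if at every point of the plane on the permanental hypersurface at least six
block values are non-zero, then the Hessian of `per_n` there has rank `≥ 6(m-1)² > n²/2`, `n = 3m + r`,
so the three basis matrices form a GOOD PLANE (`GoodPlane (3m+r)` unfolded).  Same proof as
`goodPlane_of_latinBlockNonvanishing`, inequality as hypothesis. [folklore] -/
theorem goodPlane_of_latinBlockNonvanishing' (hm2 : 2 ≤ m)
    (hineq : (3 * m + r) ^ 2 < 12 * (m - 1) ^ 2) (h : LatinBlockNonvanishing m r) :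
    ∃ w : Fin 3 → (Fin (3 * m + r) × Fin (3 * m + r) → ℂ), LinearIndependent ℂ w ∧
      ∀ a : Fin 3 → ℂ, a ≠ 0 →
        MvPolynomial.eval (∑ i, a i • w i) (perPoly (Fin (3 * m + r)) ℂ) = 0 →
        (3 * m + r) ^ 2 <
          2 * (hess0 (transl (∑ i, a i • w i) (perPoly (Fin (3 * m + r)) ℂ))).rank := by
  classical
  refine ⟨latinBasis m r, linearIndependent_latinBasis (by omega), ?_⟩
  intro a ha hper
  change MvPolynomial.eval (latinPoint m r a) _ = 0 at hper
  change _ < 2 * (hess0 (transl (latinPoint m r a) (perPoly (Fin (3 * m + r)) ℂ))).rank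
  have h6 := h hm2 a ha hper
  -- the family of blocks with non-zero value
  set T := Finset.univ.filter fun IJ : Fin 3 × Fin 3 => latinBlockValue m r hm2 a IJ.1 IJ.2 ≠ 0
    with hT
  set rows : Fin 3 → Finset (Fin (3 * m + r)) :=
    fun I => Finset.univ.filter fun i : Fin (3 * m + r) => i.val < 3 * m ∧ i.val / m = I.val
    with hrows
  have hbound := le_rank_hessPer_of_blocks (ι := T) (latinPoint m r a)
    (fun t => rows t.1.1) (fun t => rows t.1.2)
    (fun t i hi i' hi' j => by
      simp only [hrows, Finset.mem_filter, Finset.mem_univ, true_and] at hi hi'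
      exact latinPoint_row_congr a hi.1 hi'.1 (hi.2.trans hi'.2.symm) j)
    (fun t j hj j' hj' i => by
      simp only [hrows, Finset.mem_filter, Finset.mem_univ, true_and] at hj hj'
      exact latinPoint_col_congr a hj.1 hj'.1 (hj.2.trans hj'.2.symm) i)
    (fun t t' p h1 h2 h1' h2' => by
      simp only [hrows, Finset.mem_filter, Finset.mem_univ, true_and] at h1 h2 h1' h2'
      apply Subtype.ext
      exact Prod.ext (Fin.ext (h1.2.symm.trans h1'.2)) (Fin.ext (h2.2.symm.trans h2'.2)))
    (fun t => blockIdx m r hm2 t.1.1 0) (fun t => blockIdx m r hm2 t.1.1 1)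
    (fun t => blockIdx m r hm2 t.1.2 0) (fun t => blockIdx m r hm2 t.1.2 1)
    (fun t => blockIdx_mem hm2 _ _) (fun t => blockIdx_mem hm2 _ _)
    (fun t => blockIdx_zero_ne_one hm2 _)
    (fun t => blockIdx_mem hm2 _ _) (fun t => blockIdx_mem hm2 _ _)
    (fun t => blockIdx_zero_ne_one hm2 _)
    (fun t => by
      have := t.2
      simp only [hT, Finset.mem_filter, Finset.mem_univ, true_and] at this
      exact this)
  -- count: `6 (m-1)² ≤ Σ_t (|I_t| - 1)(|J_t| - 1)`
  have hcnt : 6 * ((m - 1) * (m - 1)) ≤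
      ∑ t : T, ((rows t.1.1).card - 1) * ((rows t.1.2).card - 1) := by
    have hle : ∀ t : T, (m - 1) * (m - 1) ≤ ((rows t.1.1).card - 1) * ((rows t.1.2).card - 1) :=
      fun t => Nat.mul_le_mul (Nat.sub_le_sub_right (card_blockRows_ge hm2 _) 1)
        (Nat.sub_le_sub_right (card_blockRows_ge hm2 _) 1)
    calc 6 * ((m - 1) * (m - 1)) ≤ T.card * ((m - 1) * (m - 1)) := Nat.mul_le_mul_right _ h6
      _ = ∑ _t : T, (m - 1) * (m - 1) := by
          rw [Finset.sum_const, Finset.card_univ, Fintype.card_coe, smul_eq_mul]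
      _ ≤ _ := Finset.sum_le_sum fun t _ => hle t
  have harith : (3 * m + r) ^ 2 < 2 * (6 * ((m - 1) * (m - 1))) := by
    have : 12 * (m - 1) ^ 2 = 2 * (6 * ((m - 1) * (m - 1))) := by ring
    omega
  calc (3 * m + r) ^ 2 < 2 * (6 * ((m - 1) * (m - 1))) := harith
    _ ≤ 2 * _ := Nat.mul_le_mul_left 2 (hcnt.trans hbound)

end Main

variable {p : ℕ}

/-- **Theorem P for every prime `p ≥ 11`: `GoodPlane (3p)`** (unfolded).  The Latin block
non-vanishing (★) holds for all primes `p ≥ 3` (`latinBlockNonvanishing_three_mul_prime`); the rank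
inequality `(3p)² < 12 (p-1)²` holds for `p ≥ 8`. [folklore] -/
theorem goodPlane_three_mul_prime' (hp : p.Prime) (h11 : 11 ≤ p) :
    ∃ w : Fin 3 → (Fin (3 * p + 0) × Fin (3 * p + 0) → ℂ), LinearIndependent ℂ w ∧
      ∀ a : Fin 3 → ℂ, a ≠ 0 →
        MvPolynomial.eval (∑ i, a i • w i) (perPoly (Fin (3 * p + 0)) ℂ) = 0 →
        (3 * p + 0) ^ 2 <
          2 * (hess0 (transl (∑ i, a i • w i) (perPoly (Fin (3 * p + 0)) ℂ))).rank := by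
  refine goodPlane_of_latinBlockNonvanishing' (by omega) ?_
    (latinBlockNonvanishing_three_mul_prime hp (by omega))
  obtain ⟨k, rfl⟩ : ∃ k, p = k + 11 := ⟨p - 11, by omega⟩
  rw [show k + 11 - 1 = k + 10 by omega]
  nlinarith

/-- **The crux statement at every `n = 3p`, `p ≥ 11` prime** (p1's plane criterion applied to the Latin
block plane): every non-empty hypersurface section `Z(per_n) ∩ Z(g)` contains a point where the Hessian
of `per_n` has rank `> n²/2`. [folklore] -/
theorem hessianRankCodimTwo_at_three_mul_prime' (hp : p.Prime) (h11 : 11 ≤ p)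
    (g : MvPolynomial (Fin (3 * p + 0) × Fin (3 * p + 0)) ℂ)
    (hg : ∃ q : Fin (3 * p + 0) × Fin (3 * p + 0) → ℂ,
      MvPolynomial.eval q (perPoly (Fin (3 * p + 0)) ℂ) = 0 ∧ MvPolynomial.eval q g = 0) :
    ∃ q : Fin (3 * p + 0) × Fin (3 * p + 0) → ℂ,
      MvPolynomial.eval q (perPoly (Fin (3 * p + 0)) ℂ) = 0 ∧ MvPolynomial.eval q g = 0 ∧
        (3 * p + 0) ^ 2 < 2 * (hess0 (transl q (perPoly (Fin (3 * p + 0)) ℂ))).rank :=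
  Summit.ValiantsHypothesis.ValiantsHypothesis.Theorems.GrenetZeon.HessianRankCodimTwo.planeCriterion
    (3 * p + 0) (goodPlane_three_mul_prime' hp h11) g hg

end Summit.ValiantsHypothesis.ValiantsHypothesis.Theorems.GrenetZeonHessianRankCodimTwo
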